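import Summits.QuantumFields.BalabanUV.T4Continuum.Support.HolonomyTowerRegular

/-!
# T⁴ programme, spine node NE2 (U1a), row B2.w — BRIDGES from the (3.35)+(3.36)-shape structure `RegularSites` to rows B5/B6: ONE
# regularity binder serves the componentwise model (row B2) and the Hodge-form correction (row B2.w)

NE2 formalisation swarm `t4-ne2-formalise-*`, leaf prover 10 (gen 2); companion of `Support/HolonomyTowerRegular` (leaf-03's request, CLAIMS.log
2026-08-20 «please include the bridge `RegularSites.toRegularTransporters`»).  `RegularSites L M Rb α β β₂` (size, lattice-Lipschitz, second
lattice-Lipschitz of slot-independent site transporters) RESTRICTS to row B5's `RegularBackgroundTower.RegularTransporters` of the slot lift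
`liftR (Rb k)` (leaf-10's `GaugeTermDecomposition.liftR` = the owner's `WeitzenbockBridge.slotLift`, `rfl`), and the displayed NE3-type consistency of
ALL forward difference quotients `D_lam w_ν` gives row B6's consistency of `dconnTower` (the backward quotient `D_νw_ν(· − e_ν)`) with constant
`βD + β₂` via row B5's shifted-site geometry.
 * `slotLift_eq_liftR`, `connTower_liftR_eq` (`connTower (liftR Rb) = wT`, rfl), **`RegularSites.toRegularTransporters`**,
   `dconnTower_eq_DqT_tauInv`, **`dconnTower_consistent`** (`‖Dw_{k+1}(x′) − Dw_k(parT x′)‖ ≤ (βD + β₂)/L^k`);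
 * the NE3 BINDER IN ROW B5's PHRASING: the class **`regClass₂ Rb = {w} ∪ {D_lam w_• | lam}`** of coefficient towers and
   **`perturbationLaws_hodgeCorrection_of_regular_localRate (h : RegularSites …) (hNE3 : LocalRate (bgReadings (regClass₂ Rb)) C L⁻¹) (hS)`** —
   the row-B2.w law with EXACTLY the binder shapes of row B2's `perturbationLaws_covariantLaplacian_of_regular` (`βc = βD = betaNE3 o C = 2·card o·C`
   by `NE2FromNE3.consistent_of_localRate_lev`), node NE3 being asked about the LARGER class `regClass₂ ⊇ regClass`.

HONEST FRAMING (T4-DAG p. 1).  Bookkeeping OURS at MODEL LEVEL; hypothesis structures on DATA; no B0; NE2 NOT PROVED; spine 0/9 unchanged; NOT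
infinite volume / mass gap / Clay.  HONEST DEPENDENCY: continuum YM on T⁴ ⇐ BetaPertH ∧ nine spine estimates (0/9 proved); BetaPertH ⇐ (D1) ∧
(D4) ∧ CAP+tail; G-an2-4 gates asym, D1 and NE2/3/4.  ABSOLUTE RULE kept; no `def … : Prop` fact; no `sorry`.
-/

noncomputable section

open scoped BigOperators ComplexConjugate Matrix Matrix.Norms.L2Operator Kronecker

namespace Summit.QuantumFields.BalabanUV.T4Continuum.HolonomyTowerRegular

open Literature.MathematicalPhysics.QuantumFieldTheory.Balaban1983to89.B5Prop11Plancherel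
open Literature.MathematicalPhysics.QuantumFieldTheory.Balaban1983to89.B5G183RateUnitTower (lev lev_neZero)
open Summit.QuantumFields.BalabanUV.T4Continuum
open Summit.QuantumFields.BalabanUV.T4Continuum.BalabanAveragedTowerUnit (idx)
open Summit.QuantumFields.BalabanUV.T4Continuum.BlockPairingGeometry (tau parT)
open Summit.QuantumFields.BalabanUV.T4Continuum.AbelianCovariantLaplacian (tauInv tau_tauInv)
open Literature.MathematicalPhysics.QuantumFieldTheory.Balaban1983to89.T4EtaRateMin (LocalRate)
open Summit.QuantumFields.BalabanUV.T4Continuum.BackgroundResolventTower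
open Summit.QuantumFields.BalabanUV.T4Continuum.TransportedSiteAveraging (Dc Jc)
open Summit.QuantumFields.BalabanUV.T4Continuum.ShiftedZerothOrder (ShiftLaws)
open Summit.QuantumFields.BalabanUV.T4Continuum.NE2FromNE3 (bgReadings consistent_of_localRate_lev)
open Summit.QuantumFields.BalabanUV.T4Continuum.HodgeCorrectionLaws (hodgeCorr)
open Summit.QuantumFields.BalabanUV.T4Continuum.RegularBackgroundTower (RegularTransporters connTower dconnTower betaNE3
  norm_tauInv_sub_tauInv_parT_le)
open Summit.QuantumFields.BalabanUV.T4Continuum.GaugeTermDecomposition (liftR)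
open Summit.QuantumFields.BalabanUV.T4Continuum.WeitzenbockBridge (slotLift)

variable {d : ℕ} {L : ℕ} [NeZero L] {M : Fin d → ℕ} [hM : ∀ μ, NeZero (M μ)] {o : Type*} [Fintype o] [DecidableEq o]
variable {Rb : (k : ℕ) → Fin d → Tor (fine (lev L k) M) → Matrix o o ℂ} {α β β₂ βD : ℝ}


omit [NeZero L] hM [Fintype o] [DecidableEq o] in
/-- the owner's `slotLift` and leaf-10's `liftR` are the same slot-independent lift. [folklore] -/
theorem slotLift_eq_liftR (k : ℕ) : slotLift (fine (lev L k) M) (Rb k) = liftR (fine (lev L k) M) (Rb k) := rfl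

omit [NeZero L] hM [Fintype o] in
/-- row B5's connection tower of the slot lift IS `wT`. [folklore] -/
theorem connTower_liftR_eq (k : ℕ) (ν : Fin d) (i : idx L M k) :
    connTower L M (fun k => liftR (fine (lev L k) M) (Rb k)) k ν i = wT L M Rb k ν i := rfl

omit [NeZero L] hM in
/-- **ONE REGULARITY BINDER**: the (3.35)+(3.36)-shape structure restricts to row B5's (3.35)-shape `RegularTransporters` of the slot lift (so
`hreg₂ : RegularSites …` feeds both `boundedBackgroundM_holTower` and every row-B5 consumer). [folklore] -/
theorem RegularSites.toRegularTransporters (h : RegularSites L M Rb α β β₂) :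
    RegularTransporters L M (fun k => liftR (fine (lev L k) M) (Rb k)) α β where
  nonneg := ⟨h.nonneg.1, h.nonneg.2.1⟩
  size := fun k ν i => h.size k ν i
  lipschitz := fun k ν μ i => by
    have h1 := h.lipschitz k ν μ i
    rwa [wT, wT, ← smul_sub, sub_sub_sub_cancel_right] at h1

omit [NeZero L] hM [Fintype o] in
/-- row B5's derivative tower (backward difference in the field's own direction) is the forward quotient `D_νw_ν` read at `τ_ν⁻¹ x`. [folklore] -/
theorem dconnTower_eq_DqT_tauInv (k : ℕ) (ν : Fin d) (i : idx L M k) :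
    dconnTower L M (fun k => liftR (fine (lev L k) M) (Rb k)) k ν i = DqT L M Rb ν k ν (tauInv (fine (lev L k) M) ν i) := by
  rw [DqT, tau_tauInv]; rfl

/-- **row B6's consistency of `D_νw_ν` FROM the displayed consistency of all `D_λw_ν` + the (3.36) shape**:
`‖Dw_{k+1}(x′) − Dw_k(parT x′)‖ ≤ (βD + β₂)/L^k` for `Dw = dconnTower` of the slot lift. [folklore] -/
theorem dconnTower_consistent (h : RegularSites L M Rb α β β₂)
    (hconsD : ∀ k lam ν (i : idx L M (k + 1)),
      ‖DqT L M Rb lam (k + 1) ν i - DqT L M Rb lam k ν (parT (lev L k) L M i)‖ ≤ βD / (lev L k : ℕ))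
    (k : ℕ) (ν : Fin d) (i : idx L M (k + 1)) :
    ‖dconnTower L M (fun k => liftR (fine (lev L k) M) (Rb k)) (k + 1) ν i
      - dconnTower L M (fun k => liftR (fine (lev L k) M) (Rb k)) k ν (parT (lev L k) L M i)‖ ≤ (βD + β₂) / (lev L k : ℕ) := by
  rw [dconnTower_eq_DqT_tauInv, dconnTower_eq_DqT_tauInv]
  exact norm_tauInv_sub_tauInv_parT_le (W := fun k ν' i => DqT L M Rb ν k ν' i) h.nonneg.2.2
    (fun k μ ρ i => h.lipschitz₂ k ν μ ρ i) (fun k μ i => hconsD k ν μ i) k ν ν i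


/-! ## The NE3 binder in row B5's phrasing -/

section LocalRateForm

variable (L M) in
/-- **THE CLASS OF COEFFICIENT TOWERS NODE NE3 IS ASKED ABOUT for row B2.w**: the connection `w` and ALL its forward difference quotients
`D_lam w` (larger than row B5's `regClass = {w, D_νw_ν}`). [folklore] -/
def regClass₂ (Rb : (k : ℕ) → Fin d → Tor (fine (lev L k) M) → Matrix o o ℂ) : Set ((k : ℕ) → Fin d → (idx L M k → Matrix o o ℂ)) :=
  insert (wT L M Rb) (Set.range fun lam => DqT L M Rb lam)

omit [NeZero L] hM [Fintype o] in
/-- `w ∈ regClass₂`. [folklore] -/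
theorem wT_mem_regClass₂ : wT L M Rb ∈ regClass₂ L M Rb := Set.mem_insert _ _

omit [NeZero L] hM [Fintype o] in
/-- `D_lam w ∈ regClass₂`. [folklore] -/
theorem DqT_mem_regClass₂ (lam : Fin d) : DqT L M Rb lam ∈ regClass₂ L M Rb := Set.mem_insert_of_mem _ ⟨lam, rfl⟩

variable (a : ℝ) (ha : 0 < a) {cm : ℝ}

/-- **THE ROW-B2.w LAW WITH ROW B2's BINDER SHAPES**: `hreg₂ : RegularSites Rb α β β₂` ((3.35)+(3.36) shapes), `hNE3 : LocalRate (bgReadings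
(regClass₂ Rb)) C L⁻¹` (node NE3 BY NAME on `{w} ∪ {D_lam w}`), and the mixed-shift `ShiftLaws` (`hS`, the owner's `shiftLaws_mixed`) ⟹ the target
shape for `hodgeCorr L M Rb` with `βc = βD = 2·card o·C`. [folklore] -/
theorem perturbationLaws_hodgeCorrection_of_regular_localRate (h : RegularSites L M Rb α β β₂) {C : ℝ} (hC : 0 ≤ C)
    (hNE3 : LocalRate (bgReadings L M (regClass₂ L M Rb)) C ((L : ℝ)⁻¹))
    (hS : ∀ μ ν, ShiftLaws L M a ha (fun k => ((shiftM (fine (lev L k) M) μ)ᴴ * shiftM (fine (lev L k) M) ν) ⊗ₖ (1 : Matrix o o ℂ)) cm) :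
    PerturbationLaws (Dc L M a ha) (hodgeCorr L M Rb) (Jc L M)
      ((d : ℝ) ^ 2 * ((2 * β + 2 * α ^ 2) * Cst d a))
      (fun k => (d : ℝ) ^ 2 * (Cst d a * ((2 * β + 2 * α ^ 2) * cm
        + (2 * (betaNE3 o C + β₂) + 4 * α * (betaNE3 o C + β)) * Cst d a)) * ((L : ℝ)⁻¹) ^ k) := by
  have hb : 0 ≤ betaNE3 o C := by unfold betaNE3; positivity
  have hw := consistent_of_localRate_lev L M hC hNE3 (wT_mem_regClass₂ : wT L M Rb ∈ regClass₂ L M Rb)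
  have hD := fun lam => consistent_of_localRate_lev L M hC hNE3 (DqT_mem_regClass₂ lam : DqT L M Rb lam ∈ regClass₂ L M Rb)
  exact perturbationLaws_hodgeCorrection_of_regular a ha h hb hb (fun k ν i => hw k ν i) (fun k lam ν i => hD lam k ν i) hS

end LocalRateForm

end Summit.QuantumFields.BalabanUV.T4Continuum.HolonomyTowerRegular

end
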